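/-
Copyright (c) 2026. All rights reserved.
Released under Apache 2.0 license as described in the file LICENSE.
-/
import Literature.NumberTheory.ComplexMultiplication.DegenerateCMTypesElementaryAbelianPlateauedTypes
import Literature.AlgebraicGeometry.Pohlmann1968.MultiquadraticCMFieldRankNineCensus
import HarnessLib

/-!
# The stabiliser of a plateaued CM type on an elementary abelian `2`-group: `|Stab(T)|·m ≤ L`, and the
# partially-bent types of every rank `4ⁱ + 1` attain Shimura's reflex bound `2·|Stab(T)|·(rank(T) − 1) = |G|`

SETTING (tree `DegenerateCMTypesElementaryAbelianPlateauedTypes`, `…AbelianStabilizerIndexBound`,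
`…AbelianStabilizerCharacters`; T. Kubota [Kubota1965] §2, §4 Lemma 2; G. Shimura [Shimura1998] §32.10).  `G` a finite
commutative group of exponent `2` of order `2ᴺ`, `ρ ∈ G`, `T` a CM type (`|T| = m = 2ᴺ⁻¹`), `Ŝ_T(χ) = Σ_{t∈T} χ(t)`,
`S(T) = {χ odd : Ŝ_T(χ) ≠ 0}` the surviving odd characters, `rank(T) = 1 + #S(T)` the Kubota rank,
`Stab(T) = {g : Tg = T}` the STABILISER — the joint kernel of `S(T)` (tree `forall_mul_mem_iff_of_forall_survivor`),
on the field side `Gal(K/K*)` for the smallest subfield `K*` from which the type is induced — with SHIMURA'S REFLEX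
BOUND `2·|Stab(T)|·(rank(T) − 1) ≤ |G|` (tree `two_mul_card_stabilizer_mul_typeRank_sub_one_le`) whose EQUALITY
CASE is, on the field side, Hazama's «`Bᵖ(Aⁿ) = Dᵖ(Aⁿ)` for all `n, p`» and hence the Hodge conjecture for all powers of
every abelian variety of the type (tree `Pohlmann1968.hodgeConjectureFor_pow_of_two_mul_natCard_twistStabilizer_mul_eq`),
the strict case carrying exceptional Hodge classes.  `T` is PLATEAUED OF SQUARED AMPLITUDE `L` when `Ŝ_T(χ) = 0` or
`Ŝ_T(χ)² = L` for every odd `χ` (C. Carlet [Carlet2020] §6.2.2 Definition 63; tree: `(rank(T) − 1)·L = m²`,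
`L = 4ʲ`, `rank(T) = 4ⁱ + 1`, `|G| = 2^{i+j+1}`); the PARTIALLY-BENT functions ([Carlet2020] §6.2.1 Definition 62,
«`f(x, y) = g(x) ⊕ h(y)`, `g` bent, `h` affine», Proposition 95: their linear structures form the space `E` of
dimension `n − 2·(dim of the bent part)`, and by (6.36) «the values of the Walsh transform equal `0` or
`±2^{dim(E)+dim(E′)/2}`») are plateaued.  THIS FILE proves:

> **Theorem** (`card_stabilizer_mul_card_le`, `card_stabilizer_mul_card_eq_iff`).  **`|Stab(T)|·m ≤ L` FOR EVERY
> PLATEAUED CM TYPE, WITH EQUALITY IFF `T` ATTAINS THE REFLEX BOUND `2·|Stab(T)|·(rank(T) − 1) = |G|`** (the reflex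
> bound times `L`, using `(rank − 1)·L = m²`).  So a bent type (`L = m`) has trivial stabiliser and attains the bound
> (`card_stabilizer_eq_one_of_forall_sq_eq`), and in the power form (`|G| = 2ᴺ`, `rank = 4ⁱ + 1`):
> **`|Stab(T)| ≤ 2^{N−1−2i}` with equality iff the reflex bound is attained** (`card_stabilizer_le_two_pow`,
> `card_stabilizer_eq_two_pow_iff`).
> **Theorem** (`exists_isCMTypeWith_plateaued_card_stabilizer_eq`, THE PARTIALLY-BENT TYPES).  **For every `i` with
> `2i + 1 ≤ N` there is a plateaued CM type of rank `4ⁱ + 1` with `|Stab(T)| = 2^{N−1−2i}`, attaining the reflex bound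
> `2·|Stab(T)|·(rank(T) − 1) = |G|`**: the tree's tower (a bent transversal of `⟨ρ⟩` in a closed `H ∋ ρ` of order
> `2·4ⁱ`, then `N − 1 − 2i` concatenations `T ↦ T ∪ T·a`) run with its stabiliser — each concatenation element `a`
> and all their products stabilise, `2^{N−1−2i}` elements, and the reflex bound caps `|Stab|` there.  On the field side
> (sequel): CM abelian varieties of every Mumford–Tate rank `4ⁱ + 1` all of whose powers satisfy the Hodge conjecture.
> **Theorem** (`two_mul_card_stabilizer_mul_eq_of_card_le`).  With the tree's rank-`2` theorem `2·|Stab(T)| = |G|`,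
> its rank-`5` theorem `8·|Stab(T)| = |G|` and the bent case: **ON A GROUP OF ORDER `≤ 32` EVERY PLATEAUED CM TYPE ATTAINS THE REFLEX BOUND** (ranks `2, 5` always do;
> rank `17` in order `32` is bent).  In order `64` the rank-`17` plateaued (= near-bent) types attain it iff
> `|Stab(T)| = 2` (tree `NearBentTypesStabilizer`).

* §0 helpers (characters; `2|T| = |G|`; rank `= 1 + #S`; halving a closed `H`; the `ρ`-free union `A ∪ A·a` and its
  stabiliser).
* §1 **`card_stabilizer_mul_card_le`**, **`card_stabilizer_mul_card_eq_iff`**, `card_stabilizer_eq_one_of_forall_sq_eq`,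
  `two_mul_card_stabilizer_mul_eq_of_forall_sq_eq`, **`card_stabilizer_le_two_pow`**, **`card_stabilizer_eq_two_pow_iff`**.
* §2 `exists_subset_plateaued_stab_aux` (the tower with its stabiliser),
  **`exists_isCMTypeWith_plateaued_card_stabilizer_eq`**, `exists_plateaued_two_mul_card_stabilizer_mul_eq`.
* §3 `two_mul_card_stabilizer_mul_eq_of_typeRank_eq_two`, `two_mul_card_stabilizer_mul_eq_of_typeRank_eq_five`,
  **`two_mul_card_stabilizer_mul_eq_of_card_le`** (order `≤ 32`).

HONEST SCOPE.  The sources print the reflex bound and its equality case (Shimura, Kubota), Definition 62/63,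
Proposition 95 and (6.36) (Carlet) for Boolean functions; the inequality `|Stab|·m ≤ L`, the stabiliser count along
the tower and the order-`≤ 32` statement are this file's elementary regrouping.  Not proved here: that a plateaued type
attaining the bound is induced from a bent type of `G/Stab(T)` (the converse direction of Proposition 95), nor the
existence of plateaued types NOT attaining it (e.g. primitive near-bent types in order `64`).  THEOREMS ONLY: no
definition, no named fact, no instance, no `sorry`.

## References

* [Shimura1998] G. Shimura, *Abelian Varieties with Complex Multiplication and Modular Functions*, PUP (1998), §32.10,
  §8.4 Example (1).
* [Kubota1965] T. Kubota, *On the field extension by complex multiplication*, Trans. AMS 118 (1965), §2, §4 Lemma 2.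
* [Carlet2020] C. Carlet, *Boolean Functions for Cryptography and Coding Theory*, CUP (2020), §6.2.1 Definition 62,
  Proposition 95, (6.36); §6.2.2 Definition 63 (pdf pp. 323–326).
* [ZhengZhang1999] Y. Zheng, X.-M. Zhang, *Plateaued functions*, ICICS'99, LNCS 1726 (1999) 284–300.
* [Dodson1984] B. Dodson, *The structure of Galois groups of CM-fields*, Trans. AMS 283 (1984), §3.1.1 Theorem.

## Provenance

Lane `lit-hodgefound` (Track 2, Layer A3), seat `lit-hodgefound-p10` generation 43, row g43-#7; neighbours cited by
name, nothing restated: `DegenerateCMTypesElementaryAbelianPlateauedTypes` (g43-#6: `typeRank_sub_one_mul_eq`,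
`typeRank_eq_four_pow_add_one`, USED), `DegenerateCMTypesAbelianStabilizerIndexBound`
(`two_mul_card_stabilizer_mul_typeRank_sub_one_le`, `card_stabilizer_pos`, `forall_mul_mul_mem_iff`, USED),
`DegenerateCMTypesAbelianStabilizerCharacters` (`sum_char_image_mul_eq`, USED),
`Pohlmann1968/MultiquadraticCMFieldRankNineCensus` (`two_mul_card_stabilizer_of_typeRank_eq_two`, USED),
`DegenerateCMTypesElementaryAbelianRankFive` (`eight_mul_card_stabilizer_of_typeRank_eq_five`, USED),
`DegenerateCMTypesElementaryAbelianBentTypesExistence` (`exists_subset_forall_sq_eq_of_mul_mem`, USED),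
`DegenerateCMTypesElementaryAbelianBentTypes` (`isCMTypeWith_of_forall_mul_not_mem`, USED),
`DegenerateCMTypesElementaryAbelianNearBentTypesStabilizer` (g43-#4, the order-`64` dichotomy, cited).
-/

open scoped BigOperators Classical

namespace Literature.NumberTheory.ComplexMultiplication

namespace CyclicCMType

namespace ExponentTwo

namespace PlateauedTypesStabilizer

open AbelianStabilizer (two_mul_card_stabilizer_mul_typeRank_sub_one_le card_stabilizer_pos forall_mul_mul_mem_iff
  sum_char_image_mul_eq)
open Literature.AlgebraicGeometry.Pohlmann1968 (MultiquadraticRankNineCensus.two_mul_card_stabilizer_of_typeRank_eq_two)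
open BentTypes (isCMTypeWith_of_forall_mul_not_mem)
open BentTypesExistence (exists_subset_forall_sq_eq_of_mul_mem)
open PlateauedTypes (typeRank_sub_one_mul_eq typeRank_eq_four_pow_add_one)

variable {G : Type*} [CommGroup G] [Fintype G] [DecidableEq G] {ρ : G} {T : Finset G} {L : ℕ}

/-! ## §0 Helpers -/

section Helpers

omit [Fintype G] [DecidableEq G] in
/-- `g·g = 1` in exponent `2`. [folklore] -/
private theorem mul_self_eq_one_ps (hexp : ∀ g : G, g ^ 2 = 1) (g : G) : g * g = 1 := by
  rw [← pow_two]; exact hexp g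

omit [Fintype G] [DecidableEq G] in
/-- Characters of a group of exponent `2` are `±1`-valued. [folklore] -/
private theorem char_eq_one_or_ps (hexp : ∀ g : G, g ^ 2 = 1) (χ : AddChar (Additive G) ℂ) (g : G) :
    χ (Additive.ofMul g) = 1 ∨ χ (Additive.ofMul g) = -1 :=
  character_apply_eq_one_or_of_mul_self χ (mul_self_eq_one_ps hexp g)

omit [Fintype G] [DecidableEq G] in
/-- `χ(gh) = χ(g)χ(h)`. [folklore] -/
private theorem char_mul_ps (χ : AddChar (Additive G) ℂ) (g h : G) :
    χ (Additive.ofMul (g * h)) = χ (Additive.ofMul g) * χ (Additive.ofMul h) := by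
  rw [ofMul_mul, AddChar.map_add_eq_mul]

omit [Fintype G] [DecidableEq G] in
/-- `ρx ∈ T ↔ x ∉ T` for a CM type. [folklore] -/
private theorem rho_mul_mem_iff_ps (h : IsCMTypeWith ρ (T : Set G)) (x : G) : ρ * x ∈ T ↔ x ∉ T := by
  have := h.rho_smul_mem_iff x
  simpa only [smul_eq_mul, Finset.mem_coe] using this

omit [DecidableEq G] in
/-- `2|T| = |G|` for a CM type. [folklore] -/
private theorem two_mul_card_ps (h : IsCMTypeWith ρ (T : Set G)) : 2 * T.card = Fintype.card G := by
  have hρ2 : ρ * ρ = 1 := by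
    have := h.invol (1 : G)
    simpa [smul_eq_mul] using this
  have hinj : Function.Injective fun s : G => ρ * s := fun a b hab => mul_left_cancel hab
  have hc : Tᶜ = T.image fun s => ρ * s := by
    ext x
    rw [Finset.mem_compl, Finset.mem_image]
    constructor
    · intro hx
      refine ⟨ρ * x, (rho_mul_mem_iff_ps h x).2 hx, ?_⟩
      show ρ * (ρ * x) = x
      rw [← mul_assoc, hρ2, one_mul]
    · rintro ⟨s, hs, rfl⟩
      exact fun hx => ((rho_mul_mem_iff_ps h s).1 hx) hs
  have h1 : Tᶜ.card = T.card := by rw [hc, Finset.card_image_of_injective _ hinj]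
  have h2 := Finset.card_add_card_compl T
  omega

omit [DecidableEq G] in
/-- `|T| > 0` for a CM type. [folklore] -/
private theorem card_pos_ps (h : IsCMTypeWith ρ (T : Set G)) : 0 < T.card := by
  have := two_mul_card_ps h
  have : 0 < Fintype.card G := Fintype.card_pos
  omega

omit [DecidableEq G] in
/-- Kubota's surviving odd characters as a finset. [cite: Kubota1965, §4 Lemma 2] -/
private theorem ncard_eq_card_filter_ps (T : Finset G) (ρ : G) :
    {χ : AddChar (Additive G) ℂ | χ (Additive.ofMul ρ) = -1 ∧ ∑ s ∈ T, χ (Additive.ofMul s) ≠ 0}.ncard =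
      ((Finset.univ.filter fun χ : AddChar (Additive G) ℂ => χ (Additive.ofMul ρ) = -1).filter
        fun χ => ∑ s ∈ T, χ (Additive.ofMul s) ≠ 0).card := by
  rw [← Set.ncard_coe_finset]
  congr 1
  ext χ
  simp only [Set.mem_setOf_eq, Finset.coe_filter, Finset.mem_filter, Finset.mem_univ, true_and]

omit [DecidableEq G] in
/-- `rank(T) = 1 + #S(T)` with `S(T)` as a finset. [cite: Kubota1965, §4 Lemma 2] -/
private theorem typeRank_eq_ps (h : IsCMTypeWith ρ (T : Set G)) :
    typeRank G (T : Set G) = 1 + ((Finset.univ.filter fun χ : AddChar (Additive G) ℂ =>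
      χ (Additive.ofMul ρ) = -1).filter fun χ => ∑ s ∈ T, χ (Additive.ofMul s) ≠ 0).card := by
  rw [h.typeRank_eq_one_add_ncard_oddCharacters, ncard_eq_card_filter_ps]

/-- Membership in the stabiliser finset. [folklore] -/
private theorem mem_stabilizer_ps {g : G} :
    (g ∈ Finset.univ.filter fun g : G => ∀ t : G, t * g ∈ T ↔ t ∈ T) ↔ ∀ t : G, t * g ∈ T ↔ t ∈ T := by
  simp only [Finset.mem_filter, Finset.mem_univ, true_and]

omit [DecidableEq G] in
/-- Characters separate points, with values `±1`: for `a ≠ 1` there is `χ` with `χ(a) = −1`. [folklore] -/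
private theorem exists_char_apply_eq_neg_one_ps (hexp : ∀ g : G, g ^ 2 = 1) {a : G} (ha : a ≠ 1) :
    ∃ χ : AddChar (Additive G) ℂ, χ (Additive.ofMul a) = -1 := by
  have ha0 : Additive.ofMul a ≠ 0 := fun h => ha (by simpa using congrArg Additive.toMul h)
  obtain ⟨χ, hχ⟩ := (AddChar.exists_apply_ne_zero (α := Additive G)).2 ha0
  exact ⟨χ, (char_eq_one_or_ps hexp χ a).resolve_left hχ⟩

omit [DecidableEq G] in
/-- An EVEN character with `ψ(a) = −1` for `a ∉ {1, ρ}`. [folklore] -/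
private theorem exists_even_char_apply_eq_neg_one_ps (hexp : ∀ g : G, g ^ 2 = 1) {a : G} (ha1 : a ≠ 1)
    (haρ : a ≠ ρ) :
    ∃ ψ : AddChar (Additive G) ℂ, ψ (Additive.ofMul ρ) = 1 ∧ ψ (Additive.ofMul a) = -1 := by
  obtain ⟨φ, hφ⟩ := exists_char_apply_eq_neg_one_ps hexp ha1
  rcases char_eq_one_or_ps hexp φ ρ with hφρ | hφρ
  · exact ⟨φ, hφρ, hφ⟩
  have haρ1 : a * ρ ≠ 1 := fun h =>
    haρ (mul_right_cancel (h.trans (mul_self_eq_one_ps hexp ρ).symm))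
  obtain ⟨φ', hφ'⟩ := exists_char_apply_eq_neg_one_ps hexp haρ1
  rw [char_mul_ps] at hφ'
  rcases char_eq_one_or_ps hexp φ' ρ with hφ'ρ | hφ'ρ
  · rw [hφ'ρ, mul_one] at hφ'
    exact ⟨φ', hφ'ρ, hφ'⟩
  · rw [hφ'ρ] at hφ'
    refine ⟨φ + φ', ?_, ?_⟩
    · rw [AddChar.add_apply, hφρ, hφ'ρ]; norm_num
    · rw [AddChar.add_apply, hφ]
      linear_combination hφ'

omit [Fintype G] in
/-- `x ∈ S·a ↔ xa ∈ S` in exponent `2`. [folklore] -/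
private theorem mem_image_mul_iff_ps (hexp : ∀ g : G, g ^ 2 = 1) {S : Finset G} {a x : G} :
    x ∈ S.image (fun s => s * a) ↔ x * a ∈ S := by
  constructor
  · intro hx
    obtain ⟨s, hs, rfl⟩ := Finset.mem_image.1 hx
    rwa [mul_assoc, mul_self_eq_one_ps hexp a, mul_one]
  · intro hx
    exact Finset.mem_image.2 ⟨x * a, hx, by rw [mul_assoc, mul_self_eq_one_ps hexp a, mul_one]⟩

omit [Fintype G] in
/-- `A` and `A·a` are disjoint when `A ⊆ ker ψ` and `ψ(a) = −1`. [folklore] -/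
private theorem disjoint_image_ps {A : Finset G} {ψ : AddChar (Additive G) ℂ} {a : G}
    (hψa : ψ (Additive.ofMul a) = -1) (hAψ : ∀ x ∈ A, ψ (Additive.ofMul x) = 1) :
    Disjoint A (A.image fun s => s * a) := by
  rw [Finset.disjoint_left]
  intro x hxA hxB
  obtain ⟨y, hy, hyx⟩ := Finset.mem_image.1 hxB
  have e := hAψ x hxA
  rw [← hyx, char_mul_ps, hAψ y hy, hψa, one_mul] at e
  norm_num at e

omit [Fintype G] in
/-- `|A ∪ A·a| = 2|A|` when `A ⊆ ker ψ` and `ψ(a) = −1`. [folklore] -/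
private theorem card_union_image_ps {A : Finset G} {ψ : AddChar (Additive G) ℂ} {a : G}
    (hψa : ψ (Additive.ofMul a) = -1) (hAψ : ∀ x ∈ A, ψ (Additive.ofMul x) = 1) :
    (A ∪ A.image fun s => s * a).card = 2 * A.card := by
  rw [Finset.card_union_of_disjoint (disjoint_image_ps hψa hAψ),
    Finset.card_image_of_injective _ (mul_left_injective a)]
  ring

omit [Fintype G] in
/-- `A ∪ A·a` is `ρ`-free when `A ⊆ ker ψ` is `ρ`-free, `ψ` even, `ψ(a) = −1`. [folklore] -/
private theorem union_rho_free_ps (hexp : ∀ g : G, g ^ 2 = 1) {A : Finset G} {ψ : AddChar (Additive G) ℂ}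
    (hψ : ψ (Additive.ofMul ρ) = 1) {a : G} (hψa : ψ (Additive.ofMul a) = -1)
    (hAψ : ∀ x ∈ A, ψ (Additive.ofMul x) = 1) (hAρ : ∀ x ∈ A, x * ρ ∉ A) :
    ∀ t ∈ A ∪ A.image (fun s => s * a), t * ρ ∉ A ∪ A.image (fun s => s * a) := by
  intro t ht htρ
  rw [Finset.mem_union, mem_image_mul_iff_ps hexp] at ht htρ
  have hker : ∀ x ∈ A, ∀ y : G, x * y ∈ A → ψ (Additive.ofMul y) = 1 := by
    intro x hx y hxy
    have e := hAψ _ hxy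
    rwa [char_mul_ps, hAψ x hx, one_mul] at e
  rcases ht with htA | htA
  · rcases htρ with h1 | h1
    · exact hAρ t htA h1
    · have e := hker t htA (ρ * a) (by rwa [← mul_assoc])
      rw [char_mul_ps, hψ, hψa] at e
      norm_num at e
  · rcases htρ with h1 | h1
    · have e := hker (t * a) htA (a * ρ)
        (by rw [mul_assoc, ← mul_assoc a a ρ, mul_self_eq_one_ps hexp a, one_mul]; exact h1)
      rw [char_mul_ps, hψ, hψa] at e
      norm_num at e
    · have e : t * ρ * a = t * a * ρ := mul_right_comm t ρ a
      rw [e] at h1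
      exact hAρ _ htA h1

omit [Fintype G] in
/-- A stabilising element of `T₀` stabilises `T₀ ∪ T₀·a`. [folklore] -/
private theorem stab_union_ps (hexp : ∀ g : G, g ^ 2 = 1) {T₀ : Finset G} {a b : G}
    (hb : ∀ t : G, t * b ∈ T₀ ↔ t ∈ T₀) :
    ∀ t : G, t * b ∈ T₀ ∪ T₀.image (fun s => s * a) ↔ t ∈ T₀ ∪ T₀.image (fun s => s * a) := by
  intro t
  simp only [Finset.mem_union, mem_image_mul_iff_ps hexp, mul_right_comm t b a, hb]

omit [Fintype G] in
/-- The concatenation element `a` stabilises `T₀ ∪ T₀·a`. [folklore] -/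
private theorem stab_self_ps (hexp : ∀ g : G, g ^ 2 = 1) (T₀ : Finset G) (a : G) :
    ∀ t : G, t * a ∈ T₀ ∪ T₀.image (fun s => s * a) ↔ t ∈ T₀ ∪ T₀.image (fun s => s * a) := by
  intro t
  simp only [Finset.mem_union, mem_image_mul_iff_ps hexp, mul_assoc, mul_self_eq_one_ps hexp a, mul_one]
  exact Or.comm

/-- **HALVING A CLOSED `H` BY AN EVEN CHARACTER**: for `H` multiplicatively closed with `|H| ≥ 4` there are `a ∈ H`
and an even `ψ` with `ψ(a) = −1`, and `2·|H ∩ ker ψ| = |H|`. [cite: Kubota1965, §2] -/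
private theorem exists_half_ps (hexp : ∀ g : G, g ^ 2 = 1) {H : Finset G}
    (hmul : ∀ x ∈ H, ∀ y ∈ H, x * y ∈ H) (h4 : 4 ≤ H.card) :
    ∃ a ∈ H, ∃ ψ : AddChar (Additive G) ℂ, ψ (Additive.ofMul ρ) = 1 ∧ ψ (Additive.ofMul a) = -1 ∧
      2 * (H.filter fun h => ψ (Additive.ofMul h) = 1).card = H.card := by
  obtain ⟨a, haH, ha⟩ : ∃ a ∈ H, a ∉ ({1, ρ} : Finset G) :=
    Finset.exists_mem_notMem_of_card_lt_card (lt_of_le_of_lt Finset.card_le_two (by omega))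
  simp only [Finset.mem_insert, Finset.mem_singleton, not_or] at ha
  obtain ⟨ha1, haρ⟩ := ha
  obtain ⟨ψ, hψ, hψa⟩ := exists_even_char_apply_eq_neg_one_ps hexp ha1 haρ
  refine ⟨a, haH, ψ, hψ, hψa, ?_⟩
  have himg : (H.filter fun h => ¬ ψ (Additive.ofMul h) = 1) =
      (H.filter fun h => ψ (Additive.ofMul h) = 1).image fun s => s * a := by
    ext x
    simp only [Finset.mem_filter, Finset.mem_image]
    constructor
    · rintro ⟨hx, hψx⟩
      have hψx' : ψ (Additive.ofMul x) = -1 := (char_eq_one_or_ps hexp ψ x).resolve_left hψx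
      refine ⟨x * a, ⟨hmul x hx a haH, by rw [char_mul_ps, hψx', hψa]; norm_num⟩, ?_⟩
      rw [mul_assoc, mul_self_eq_one_ps hexp a, mul_one]
    · rintro ⟨s, ⟨hs, hψs⟩, rfl⟩
      refine ⟨hmul s hs a haH, ?_⟩
      rw [char_mul_ps, hψs, hψa]
      norm_num
  have hsplit := Finset.card_filter_add_card_filter_not (s := H) (fun h => ψ (Additive.ofMul h) = 1)
  rw [himg, Finset.card_image_of_injective _ (mul_left_injective a)] at hsplit
  omega

end Helpers

/-! ## §1 `|Stab(T)|·m ≤ L`, with equality iff the reflex bound is attained -/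

section Bound

/-- **`|Stab(T)|·m ≤ L` FOR A PLATEAUED CM TYPE OF SQUARED AMPLITUDE `L`**: Shimura's reflex bound
`2·|Stab(T)|·(rank(T) − 1) ≤ |G| = 2m` multiplied by `L`, with `(rank(T) − 1)·L = m²`.  Bent (`L = m`): `|Stab| = 1`;
near-bent (`L = 2m`): `|Stab| ≤ 2`; rank `2` (`L = m²`): `|Stab| ≤ m`. [cite: Shimura1998, §32.10]
[cite: Kubota1965, §4 Lemma 2] [cite: Carlet2020, §6.2.2 Definition 63] -/
theorem card_stabilizer_mul_card_le (hexp : ∀ g : G, g ^ 2 = 1) (h : IsCMTypeWith ρ (T : Set G))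
    (hpl : ∀ χ : AddChar (Additive G) ℂ, χ (Additive.ofMul ρ) = -1 →
      ∑ t ∈ T, χ (Additive.ofMul t) = 0 ∨ (∑ t ∈ T, χ (Additive.ofMul t)) ^ 2 = (L : ℂ)) :
    (Finset.univ.filter fun g : G => ∀ t : G, t * g ∈ T ↔ t ∈ T).card * T.card ≤ L := by
  have hb := two_mul_card_stabilizer_mul_typeRank_sub_one_le h
  have hk := typeRank_sub_one_mul_eq hexp h hpl
  have hm := two_mul_card_ps h
  have hmpos := card_pos_ps h
  set S := (Finset.univ.filter fun g : G => ∀ t : G, t * g ∈ T ↔ t ∈ T).card with hS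
  set r1 := typeRank G (T : Set G) - 1 with hr1
  have h1 : S * r1 ≤ T.card := by
    have : 2 * (S * r1) ≤ 2 * T.card := by rw [← mul_assoc, hm]; exact hb
    exact Nat.le_of_mul_le_mul_left this (by norm_num)
  have h3 : S * T.card * T.card ≤ L * T.card :=
    calc S * T.card * T.card = S * (r1 * L) := by rw [hk]; ring
      _ = S * r1 * L := by ring
      _ ≤ T.card * L := Nat.mul_le_mul_right L h1
      _ = L * T.card := mul_comm _ _
  exact Nat.le_of_mul_le_mul_right h3 hmpos

/-- **`|Stab(T)|·m = L` IFF THE REFLEX BOUND IS ATTAINED, `2·|Stab(T)|·(rank(T) − 1) = |G|`** (plateaued `T` of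
squared amplitude `L`; on the field side Hazama's equality case, the Hodge conjecture for all powers).
[cite: Shimura1998, §32.10] [cite: Kubota1965, §4 Lemma 2] [cite: Carlet2020, §6.2.2 Definition 63] -/
theorem card_stabilizer_mul_card_eq_iff (hexp : ∀ g : G, g ^ 2 = 1) (h : IsCMTypeWith ρ (T : Set G))
    (hpl : ∀ χ : AddChar (Additive G) ℂ, χ (Additive.ofMul ρ) = -1 →
      ∑ t ∈ T, χ (Additive.ofMul t) = 0 ∨ (∑ t ∈ T, χ (Additive.ofMul t)) ^ 2 = (L : ℂ)) :
    (Finset.univ.filter fun g : G => ∀ t : G, t * g ∈ T ↔ t ∈ T).card * T.card = L ↔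
      2 * (Finset.univ.filter fun g : G => ∀ t : G, t * g ∈ T ↔ t ∈ T).card * (typeRank G (T : Set G) - 1) =
        Fintype.card G := by
  have hk := typeRank_sub_one_mul_eq hexp h hpl
  have hm := two_mul_card_ps h
  have hmpos := card_pos_ps h
  set S := (Finset.univ.filter fun g : G => ∀ t : G, t * g ∈ T ↔ t ∈ T).card with hS
  set r1 := typeRank G (T : Set G) - 1 with hr1
  constructor
  · intro hSL
    have e : r1 * S * T.card = T.card * T.card := by rw [mul_assoc, hSL, hk, sq]
    have e2 : r1 * S = T.card := Nat.eq_of_mul_eq_mul_right hmpos e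
    rw [← hm, ← e2]
    ring
  · intro heq
    rw [← hm] at heq
    have e2 : S * r1 = T.card := by
      have : 2 * (S * r1) = 2 * T.card := by rw [← mul_assoc]; exact heq
      exact Nat.eq_of_mul_eq_mul_left (by norm_num) this
    have e3 : S * T.card * T.card = L * T.card :=
      calc S * T.card * T.card = S * (r1 * L) := by rw [hk]; ring
        _ = S * r1 * L := by ring
        _ = T.card * L := by rw [e2]
        _ = L * T.card := mul_comm _ _
    exact Nat.eq_of_mul_eq_mul_right hmpos e3

/-- **A BENT TYPE HAS TRIVIAL STABILISER** (`L = m`: `|Stab|·m ≤ m`) — bent types are primitive.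
[cite: Shimura1998, §32.10] [cite: Kubota1965, §4 Lemma 2] [cite: Dodson1984, §3.1.1 Theorem] -/
theorem card_stabilizer_eq_one_of_forall_sq_eq (hexp : ∀ g : G, g ^ 2 = 1) (h : IsCMTypeWith ρ (T : Set G))
    (hbent : ∀ χ : AddChar (Additive G) ℂ, χ (Additive.ofMul ρ) = -1 →
      (∑ t ∈ T, χ (Additive.ofMul t)) ^ 2 = (T.card : ℂ)) :
    (Finset.univ.filter fun g : G => ∀ t : G, t * g ∈ T ↔ t ∈ T).card = 1 := by
  have hpl : ∀ χ : AddChar (Additive G) ℂ, χ (Additive.ofMul ρ) = -1 →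
      ∑ t ∈ T, χ (Additive.ofMul t) = 0 ∨ (∑ t ∈ T, χ (Additive.ofMul t)) ^ 2 = ((T.card : ℕ) : ℂ) :=
    fun χ hχ => Or.inr (hbent χ hχ)
  have h1 := card_stabilizer_mul_card_le hexp h hpl
  have hpos := card_stabilizer_pos T
  have hm := card_pos_ps h
  have h2 : (Finset.univ.filter fun g : G => ∀ t : G, t * g ∈ T ↔ t ∈ T).card ≤ 1 :=
    Nat.le_of_mul_le_mul_right (h1.trans (one_mul _).symm.le) hm
  omega

/-- **A BENT TYPE ATTAINS THE REFLEX BOUND**: `2·|Stab(T)|·(rank(T) − 1) = 2·1·m = |G|` (the nondegenerate case).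
[cite: Shimura1998, §32.10] [cite: Kubota1965, §4 Lemma 2] -/
theorem two_mul_card_stabilizer_mul_eq_of_forall_sq_eq (hexp : ∀ g : G, g ^ 2 = 1) (h : IsCMTypeWith ρ (T : Set G))
    (hbent : ∀ χ : AddChar (Additive G) ℂ, χ (Additive.ofMul ρ) = -1 →
      (∑ t ∈ T, χ (Additive.ofMul t)) ^ 2 = (T.card : ℂ)) :
    2 * (Finset.univ.filter fun g : G => ∀ t : G, t * g ∈ T ↔ t ∈ T).card * (typeRank G (T : Set G) - 1) =
      Fintype.card G := by
  have hpl : ∀ χ : AddChar (Additive G) ℂ, χ (Additive.ofMul ρ) = -1 →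
      ∑ t ∈ T, χ (Additive.ofMul t) = 0 ∨ (∑ t ∈ T, χ (Additive.ofMul t)) ^ 2 = ((T.card : ℕ) : ℂ) :=
    fun χ hχ => Or.inr (hbent χ hχ)
  rw [← card_stabilizer_mul_card_eq_iff hexp h hpl, card_stabilizer_eq_one_of_forall_sq_eq hexp h hbent, one_mul]

/-- **`|Stab(T)| ≤ 2^{N−1−2i}` FOR A CM TYPE OF RANK `4ⁱ + 1` ON A GROUP OF ORDER `2ᴺ`** (every plateaued type has
such a rank, tree `typeRank_eq_four_pow_add_one`), and `2i + 1 ≤ N`: the reflex bound `2·|Stab|·4ⁱ ≤ 2ᴺ`.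
[cite: Shimura1998, §32.10] [cite: Kubota1965, §4 Lemma 2] -/
theorem card_stabilizer_le_two_pow (h : IsCMTypeWith ρ (T : Set G)) {N i : ℕ} (hN : Fintype.card G = 2 ^ N)
    (hr : typeRank G (T : Set G) = 4 ^ i + 1) :
    2 * i + 1 ≤ N ∧ (Finset.univ.filter fun g : G => ∀ t : G, t * g ∈ T ↔ t ∈ T).card ≤ 2 ^ (N - 1 - 2 * i) := by
  have hb := two_mul_card_stabilizer_mul_typeRank_sub_one_le h
  rw [hr, Nat.add_sub_cancel, hN] at hb
  have hpos := card_stabilizer_pos T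
  set S := (Finset.univ.filter fun g : G => ∀ t : G, t * g ∈ T ↔ t ∈ T).card with hS
  have h4 : (4 : ℕ) ^ i = 2 ^ (2 * i) := by
    rw [pow_mul, show (2 : ℕ) ^ 2 = 4 by norm_num]
  have hle : 2 ^ (2 * i + 1) ≤ 2 ^ N :=
    calc 2 ^ (2 * i + 1) = 2 * 1 * 4 ^ i := by rw [h4, pow_succ]; ring
      _ ≤ 2 * S * 4 ^ i := Nat.mul_le_mul_right _ (Nat.mul_le_mul_left _ hpos)
      _ ≤ 2 ^ N := hb
  have hi : 2 * i + 1 ≤ N := (Nat.pow_le_pow_iff_right (by norm_num : 1 < 2)).1 hle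
  refine ⟨hi, ?_⟩
  obtain ⟨d, hd⟩ : ∃ d, N = 2 * i + 1 + d := ⟨N - (2 * i + 1), by omega⟩
  have hNd : N - 1 - 2 * i = d := by omega
  rw [hNd]
  have key : 2 * 4 ^ i * S ≤ 2 * 4 ^ i * 2 ^ d :=
    calc 2 * 4 ^ i * S = 2 * S * 4 ^ i := by ring
      _ ≤ 2 ^ N := hb
      _ = 2 * 4 ^ i * 2 ^ d := by rw [hd, pow_add, pow_succ, h4]; ring
  exact Nat.le_of_mul_le_mul_left key (by positivity)

/-- **`|Stab(T)| = 2^{N−1−2i}` IFF THE REFLEX BOUND IS ATTAINED** (rank `4ⁱ + 1`, `|G| = 2ᴺ`).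
[cite: Shimura1998, §32.10] [cite: Kubota1965, §4 Lemma 2] -/
theorem card_stabilizer_eq_two_pow_iff (h : IsCMTypeWith ρ (T : Set G)) {N i : ℕ} (hN : Fintype.card G = 2 ^ N)
    (hr : typeRank G (T : Set G) = 4 ^ i + 1) :
    (Finset.univ.filter fun g : G => ∀ t : G, t * g ∈ T ↔ t ∈ T).card = 2 ^ (N - 1 - 2 * i) ↔
      2 * (Finset.univ.filter fun g : G => ∀ t : G, t * g ∈ T ↔ t ∈ T).card * (typeRank G (T : Set G) - 1) =
        Fintype.card G := by
  obtain ⟨hi, -⟩ := card_stabilizer_le_two_pow h hN hr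
  obtain ⟨d, hd⟩ : ∃ d, N = 2 * i + 1 + d := ⟨N - (2 * i + 1), by omega⟩
  have hNd : N - 1 - 2 * i = d := by omega
  have h4 : (4 : ℕ) ^ i = 2 ^ (2 * i) := by
    rw [pow_mul, show (2 : ℕ) ^ 2 = 4 by norm_num]
  have hG : Fintype.card G = 2 * 4 ^ i * 2 ^ d := by rw [hN, hd, pow_add, pow_succ, h4]; ring
  rw [hNd, hr, Nat.add_sub_cancel, hG]
  set S := (Finset.univ.filter fun g : G => ∀ t : G, t * g ∈ T ↔ t ∈ T).card with hS
  constructor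
  · intro hSd
    rw [hSd]
    ring
  · intro heq
    have : 2 * 4 ^ i * S = 2 * 4 ^ i * 2 ^ d := by rw [← heq]; ring
    exact Nat.eq_of_mul_eq_mul_left (by positivity) this

end Bound

/-! ## §2 The partially-bent types: the tower with its stabiliser -/

section Tower

/-- THE TOWER WITH ITS STABILISER: inside every closed `H ∋ ρ` of order `2·4ⁱ·2ᵈ` there is a transversal `T` of
`⟨ρ⟩` in `H` with `Σ_T χ = 0` or `(Σ_T χ)² = 4^{i+d}` for every odd `χ`, TOGETHER WITH `2ᵈ` ELEMENTS OF `H`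
STABILISING `T` (the concatenation elements and their products). [cite: Carlet2020, §6.2.1 Definition 62 and (6.36)]
[cite: Kubota1965, §2] -/
private theorem exists_subset_plateaued_stab_aux (hexp : ∀ g : G, g ^ 2 = 1) (hρ1 : ρ ≠ 1) (i : ℕ) :
    ∀ (d : ℕ) (H : Finset G), ρ ∈ H → (∀ x ∈ H, ∀ y ∈ H, x * y ∈ H) → H.card = 2 * 4 ^ i * 2 ^ d →
      ∃ T : Finset G, T ⊆ H ∧ (∀ t ∈ T, t * ρ ∉ T) ∧ 2 * T.card = H.card ∧
        (∀ χ : AddChar (Additive G) ℂ, χ (Additive.ofMul ρ) = -1 →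
          ∑ t ∈ T, χ (Additive.ofMul t) = 0 ∨ (∑ t ∈ T, χ (Additive.ofMul t)) ^ 2 = ((4 ^ (i + d) : ℕ) : ℂ)) ∧
        ∃ A : Finset G, A ⊆ H ∧ A.card = 2 ^ d ∧ ∀ a ∈ A, ∀ t : G, t * a ∈ T ↔ t ∈ T := by
  intro d
  induction d with
  | zero =>
    intro H hρH hmul hcard
    rw [pow_zero, mul_one] at hcard
    obtain ⟨T, hTH, hTρ, hTcard, hbent⟩ := exists_subset_forall_sq_eq_of_mul_mem hexp hρ1 hρH hmul hcard
    have h1H : (1 : G) ∈ H := by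
      have := hmul ρ hρH ρ hρH
      rwa [mul_self_eq_one_ps hexp ρ] at this
    refine ⟨T, hTH, hTρ, by rw [hTcard, hcard], fun χ hχ => Or.inr ?_, {1}, by simpa using h1H, by simp, ?_⟩
    · rw [hbent χ hχ, hTcard, add_zero]
    · intro a ha t
      rw [Finset.mem_singleton] at ha
      rw [ha, mul_one]
  | succ d ih =>
    intro H hρH hmul hcard
    have h4 : 4 ≤ H.card := by
      rw [hcard, pow_succ]
      have : 1 ≤ 4 ^ i * 2 ^ d := Nat.one_le_iff_ne_zero.2 (by positivity)
      nlinarith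
    obtain ⟨a, haH, ψ, hψ, hψa, hhalf⟩ := exists_half_ps (ρ := ρ) hexp hmul h4
    set H₀ := H.filter (fun h => ψ (Additive.ofMul h) = 1) with hH₀
    have hρH₀ : ρ ∈ H₀ := Finset.mem_filter.2 ⟨hρH, hψ⟩
    have hmul₀ : ∀ x ∈ H₀, ∀ y ∈ H₀, x * y ∈ H₀ := by
      intro x hx y hy
      obtain ⟨hxH, hψx⟩ := Finset.mem_filter.1 hx
      obtain ⟨hyH, hψy⟩ := Finset.mem_filter.1 hy
      exact Finset.mem_filter.2 ⟨hmul x hxH y hyH, by rw [char_mul_ps, hψx, hψy, one_mul]⟩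
    have hcard₀ : H₀.card = 2 * 4 ^ i * 2 ^ d := by
      have : 2 * H₀.card = 2 * (2 * 4 ^ i * 2 ^ d) := by rw [hhalf, hcard, pow_succ]; ring
      omega
    obtain ⟨T₀, hT₀H₀, hT₀ρ, hT₀card, hpl₀, A₀, hA₀H₀, hA₀card, hA₀stab⟩ := ih H₀ hρH₀ hmul₀ hcard₀
    have hT₀ψ : ∀ x ∈ T₀, ψ (Additive.ofMul x) = 1 := fun x hx => (Finset.mem_filter.1 (hT₀H₀ hx)).2
    have hA₀ψ : ∀ x ∈ A₀, ψ (Additive.ofMul x) = 1 := fun x hx => (Finset.mem_filter.1 (hA₀H₀ hx)).2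
    refine ⟨T₀ ∪ T₀.image (fun s => s * a), ?_, union_rho_free_ps hexp hψ hψa hT₀ψ hT₀ρ, ?_, ?_,
      A₀ ∪ A₀.image (fun s => s * a), ?_, ?_, ?_⟩
    · -- inside `H`
      intro t ht
      rcases Finset.mem_union.1 ht with h1 | h1
      · exact (Finset.mem_filter.1 (hT₀H₀ h1)).1
      · obtain ⟨x, hx, rfl⟩ := Finset.mem_image.1 h1
        exact hmul x (Finset.mem_filter.1 (hT₀H₀ hx)).1 a haH
    · -- `2|T| = |H|`
      rw [card_union_image_ps hψa hT₀ψ, ← hhalf, ← hT₀card]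
    · -- the sums: `Σ_T χ = (1 + χ(a))·Σ_{T₀} χ`
      intro χ hχ
      have hS : ∑ t ∈ T₀ ∪ T₀.image (fun s => s * a), χ (Additive.ofMul t) =
          (1 + χ (Additive.ofMul a)) * ∑ t ∈ T₀, χ (Additive.ofMul t) := by
        rw [Finset.sum_union (disjoint_image_ps hψa hT₀ψ), sum_char_image_mul_eq]
        ring
      rw [hS]
      rcases char_eq_one_or_ps hexp χ a with ha1 | ha1
      · rcases hpl₀ χ hχ with h0 | h2
        · left
          rw [h0, mul_zero]
        · right
          rw [ha1, mul_pow, h2]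
          push_cast
          ring
      · left
        rw [ha1]
        ring
    · -- `A ⊆ H`
      intro c hc
      rcases Finset.mem_union.1 hc with h1 | h1
      · exact (Finset.mem_filter.1 (hA₀H₀ h1)).1
      · obtain ⟨x, hx, rfl⟩ := Finset.mem_image.1 h1
        exact hmul x (Finset.mem_filter.1 (hA₀H₀ hx)).1 a haH
    · -- `|A| = 2^{d+1}`
      rw [card_union_image_ps hψa hA₀ψ, hA₀card, pow_succ, mul_comm]
    · -- every element of `A` stabilises
      intro c hc
      rcases Finset.mem_union.1 hc with h1 | h1
      · exact stab_union_ps hexp (hA₀stab c h1)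
      · obtain ⟨b, hb, rfl⟩ := Finset.mem_image.1 h1
        exact forall_mul_mul_mem_iff (stab_union_ps hexp (hA₀stab b hb)) (stab_self_ps hexp T₀ a)

/-- **THE PARTIALLY-BENT TYPES ATTAIN THE REFLEX BOUND.**  On a finite commutative group `G` of exponent `2` of order
`2ᴺ`, for every `ρ ≠ 1` and every `i` with `2i + 1 ≤ N` there is a CM type `T` w.r.t. `ρ`, plateaued of squared
amplitude `4^{N−1−i}`, of Kubota rank `4ⁱ + 1`, whose stabiliser has order EXACTLY `2^{N−1−2i}`, so that
**`2·|Stab(T)|·(rank(T) − 1) = |G|`** — the partially-bent function `x₁x₂ ⊕ ⋯ ⊕ x_{2i−1}x_{2i}` of `n = N − 1` variables,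
whose linear structures form a space of dimension `n − 2i`.  On the field side (Hazama's equality case): a CM abelian
variety of Mumford–Tate rank `4ⁱ + 1` all of whose powers satisfy the Hodge conjecture.
[cite: Carlet2020, §6.2.1 Definition 62, Proposition 95 and (6.36)] [cite: Shimura1998, §32.10] [cite: Kubota1965, §4 Lemma 2] -/
theorem exists_isCMTypeWith_plateaued_card_stabilizer_eq (hexp : ∀ g : G, g ^ 2 = 1) (hρ1 : ρ ≠ 1) {N i : ℕ}
    (hN : Fintype.card G = 2 ^ N) (hi : 2 * i + 1 ≤ N) :
    ∃ T : Finset G, IsCMTypeWith ρ (T : Set G) ∧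
      (∀ χ : AddChar (Additive G) ℂ, χ (Additive.ofMul ρ) = -1 →
        ∑ t ∈ T, χ (Additive.ofMul t) = 0 ∨ (∑ t ∈ T, χ (Additive.ofMul t)) ^ 2 = ((4 ^ (N - 1 - i) : ℕ) : ℂ)) ∧
      typeRank G (T : Set G) = 4 ^ i + 1 ∧
      (Finset.univ.filter fun g : G => ∀ t : G, t * g ∈ T ↔ t ∈ T).card = 2 ^ (N - 1 - 2 * i) ∧
      2 * (Finset.univ.filter fun g : G => ∀ t : G, t * g ∈ T ↔ t ∈ T).card * (typeRank G (T : Set G) - 1) =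
        Fintype.card G := by
  obtain ⟨d, hd⟩ : ∃ d, N = 2 * i + 1 + d := ⟨N - (2 * i + 1), by omega⟩
  have h4 : (4 : ℕ) ^ i = 2 ^ (2 * i) := by
    rw [pow_mul, show (2 : ℕ) ^ 2 = 4 by norm_num]
  have hG : Fintype.card G = 2 * 4 ^ i * 2 ^ d := by rw [hN, hd, pow_add, pow_succ, h4]; ring
  have hcard : (Finset.univ : Finset G).card = 2 * 4 ^ i * 2 ^ d := by rw [Finset.card_univ, hG]
  obtain ⟨T, -, hTρ, hTcard, hpl, A, -, hAcard, hAstab⟩ := exists_subset_plateaued_stab_aux hexp hρ1 i d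
    Finset.univ (Finset.mem_univ _) (fun _ _ _ _ => Finset.mem_univ _) hcard
  rw [Finset.card_univ] at hTcard
  have hT : IsCMTypeWith ρ (T : Set G) := isCMTypeWith_of_forall_mul_not_mem hexp hTcard hTρ
  have hid : i + d = N - 1 - i := by omega
  rw [hid] at hpl
  -- the rank from `(rank − 1)·L = m²`
  have hr : typeRank G (T : Set G) = 4 ^ i + 1 := by
    have hk := typeRank_sub_one_mul_eq hexp hT hpl
    have hm : T.card = 2 ^ (N - 1) := by
      have h2 : 2 * T.card = 2 ^ N := by rw [hTcard, hN]
      have hN1 : N = (N - 1) + 1 := by omega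
      rw [hN1, pow_succ] at h2
      omega
    rw [hm, ← pow_mul] at hk
    have hpow : (4 : ℕ) ^ i * 4 ^ (N - 1 - i) = 2 ^ ((N - 1) * 2) := by
      rw [← pow_add, show (4 : ℕ) = 2 ^ 2 by norm_num, ← pow_mul]
      congr 1
      omega
    rw [← hpow] at hk
    have e := Nat.eq_of_mul_eq_mul_right (pow_pos (by norm_num : (0 : ℕ) < 4) (N - 1 - i)) hk
    have h4i : 0 < 4 ^ i := pow_pos (by norm_num) i
    omega
  -- the stabiliser: `A ⊆ Stab` gives `2ᵈ ≤ |Stab|`, the reflex bound gives `|Stab| ≤ 2ᵈ`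
  have hlow : 2 ^ d ≤ (Finset.univ.filter fun g : G => ∀ t : G, t * g ∈ T ↔ t ∈ T).card := by
    rw [← hAcard]
    exact Finset.card_le_card fun a ha => mem_stabilizer_ps.2 (hAstab a ha)
  obtain ⟨-, hup⟩ := card_stabilizer_le_two_pow hT hN hr
  have hNd : N - 1 - 2 * i = d := by omega
  rw [hNd] at hup
  have hS : (Finset.univ.filter fun g : G => ∀ t : G, t * g ∈ T ↔ t ∈ T).card = 2 ^ d := le_antisymm hup hlow
  refine ⟨T, hT, hpl, hr, by rw [hS, hNd], ?_⟩
  rw [hS, hr, Nat.add_sub_cancel, hG]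
  ring

/-- **FOR EVERY ADMISSIBLE RANK A PLATEAUED TYPE ATTAINING THE REFLEX BOUND EXISTS** (`|G| = 2ᴺ`, `ρ ≠ 1`): for
each `r = 4ⁱ + 1` with `2i + 1 ≤ N` — i.e. (tree `exists_plateaued_typeRank_eq_iff`) for every rank of a plateaued
type — some plateaued CM type of rank `r` satisfies `2·|Stab(T)|·(rank(T) − 1) = |G|`.
[cite: Carlet2020, §6.2.1 (6.36)] [cite: Shimura1998, §32.10] [cite: Kubota1965, §4 Lemma 2] -/
theorem exists_plateaued_two_mul_card_stabilizer_mul_eq (hexp : ∀ g : G, g ^ 2 = 1) (hρ1 : ρ ≠ 1) {N i : ℕ}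
    (hN : Fintype.card G = 2 ^ N) (hi : 2 * i + 1 ≤ N) :
    ∃ T : Finset G, IsCMTypeWith ρ (T : Set G) ∧
      (∃ L : ℕ, ∀ χ : AddChar (Additive G) ℂ, χ (Additive.ofMul ρ) = -1 →
        ∑ t ∈ T, χ (Additive.ofMul t) = 0 ∨ (∑ t ∈ T, χ (Additive.ofMul t)) ^ 2 = (L : ℂ)) ∧
      typeRank G (T : Set G) = 4 ^ i + 1 ∧
      2 * (Finset.univ.filter fun g : G => ∀ t : G, t * g ∈ T ↔ t ∈ T).card * (typeRank G (T : Set G) - 1) =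
        Fintype.card G := by
  obtain ⟨T, hT, hpl, hr, -, heq⟩ := exists_isCMTypeWith_plateaued_card_stabilizer_eq hexp hρ1 hN hi
  exact ⟨T, hT, ⟨4 ^ (N - 1 - i), hpl⟩, hr, heq⟩

end Tower

/-! ## §3 Ranks `2` and `5` always attain the bound; orders `≤ 32` -/

section SmallRank

/-- **A RANK-`2` TYPE ATTAINS THE REFLEX BOUND**: `2·|Stab(T)|·(2 − 1) = |G|` (tree
`MultiquadraticRankNineCensus.two_mul_card_stabilizer_of_typeRank_eq_two`: `|Stab(T)| = |G|/2`, the kernel of the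
unique survivor). [cite: Shimura1998, §32.10] [cite: Kubota1965, §4 Lemma 2] -/
theorem two_mul_card_stabilizer_mul_eq_of_typeRank_eq_two (hexp : ∀ g : G, g ^ 2 = 1)
    (h : IsCMTypeWith ρ (T : Set G)) (hr : typeRank G (T : Set G) = 2) :
    2 * (Finset.univ.filter fun g : G => ∀ t : G, t * g ∈ T ↔ t ∈ T).card * (typeRank G (T : Set G) - 1) =
      Fintype.card G := by
  rw [hr, ← MultiquadraticRankNineCensus.two_mul_card_stabilizer_of_typeRank_eq_two hexp h hr]
  norm_num

/-- **A RANK-`5` TYPE ATTAINS THE REFLEX BOUND**: `2·|Stab(T)|·4 = 8·|Stab(T)| = |G|` (tree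
`eight_mul_card_stabilizer_of_typeRank_eq_five`: a rank-`5` type is a translate of a majority type, induced from an
octic quotient). [cite: Shimura1998, §32.10 and §8.4 Example (1)] [cite: Kubota1965, §4 Lemma 2] -/
theorem two_mul_card_stabilizer_mul_eq_of_typeRank_eq_five (hexp : ∀ g : G, g ^ 2 = 1)
    (h : IsCMTypeWith ρ (T : Set G)) (hr : typeRank G (T : Set G) = 5) :
    2 * (Finset.univ.filter fun g : G => ∀ t : G, t * g ∈ T ↔ t ∈ T).card * (typeRank G (T : Set G) - 1) =
      Fintype.card G := by
  have h8 := eight_mul_card_stabilizer_of_typeRank_eq_five hexp h hr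
  rw [hr]
  omega

/-- **ON A GROUP OF ORDER AT MOST `32` EVERY PLATEAUED CM TYPE ATTAINS THE REFLEX BOUND
`2·|Stab(T)|·(rank(T) − 1) = |G|`**: a plateaued type has rank `4ⁱ + 1` with `2i + 1 ≤ N ≤ 5`, so rank `2` or `5`
(always extremal) or, in order `32` only, rank `17 = m + 1` — then `16·L = 16²`, `L = m`, the type is bent and
`|Stab| = 1`.  (Order `64`: the rank-`17` plateaued types are the near-bent ones, extremal iff `|Stab(T)| = 2`, tree
`NearBentTypesStabilizer`.)  On the field side: for multiquadratic CM fields of degree `≤ 32` every abelian variety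
with a plateaued CM type satisfies the Hodge conjecture together with all its powers.
[cite: Shimura1998, §32.10] [cite: Kubota1965, §4 Lemma 2] [cite: Carlet2020, §6.2.2 Definition 63] -/
theorem two_mul_card_stabilizer_mul_eq_of_card_le (hexp : ∀ g : G, g ^ 2 = 1) (h : IsCMTypeWith ρ (T : Set G))
    (hpl : ∀ χ : AddChar (Additive G) ℂ, χ (Additive.ofMul ρ) = -1 →
      ∑ t ∈ T, χ (Additive.ofMul t) = 0 ∨ (∑ t ∈ T, χ (Additive.ofMul t)) ^ 2 = (L : ℂ))
    (hG : Fintype.card G ≤ 32) :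
    2 * (Finset.univ.filter fun g : G => ∀ t : G, t * g ∈ T ↔ t ∈ T).card * (typeRank G (T : Set G) - 1) =
      Fintype.card G := by
  obtain ⟨i, j, hij, hL, hr, hN⟩ := PlateauedTypes.exists_eq_four_pow hexp h hpl
  -- `2^{i+j+1} ≤ 32` with `i ≤ j`: `i ≤ 2`, and `i = 2` forces `j = 2`
  have hle : 2 ^ (i + j + 1) ≤ 2 ^ 5 := by rw [← hN]; exact hG
  have hij5 : i + j + 1 ≤ 5 := (Nat.pow_le_pow_iff_right (by norm_num : 1 < 2)).1 hle
  have hi : i ≤ 2 := by omega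
  interval_cases i
  · exact two_mul_card_stabilizer_mul_eq_of_typeRank_eq_two hexp h (by rw [hr]; norm_num)
  · exact two_mul_card_stabilizer_mul_eq_of_typeRank_eq_five hexp h (by rw [hr]; norm_num)
  · -- bent: `L = 4² = 16 = m`
    have hj : j = 2 := by omega
    subst hj
    have hm : T.card = 16 := by
      have := two_mul_card_ps h
      rw [hN] at this
      norm_num at this
      omega
    have hbent := (PlateauedTypes.eq_card_iff_forall_sq_eq hexp h hpl).1 (by rw [hL, hm]; norm_num)
    exact two_mul_card_stabilizer_mul_eq_of_forall_sq_eq hexp h hbent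

end SmallRank

end PlateauedTypesStabilizer

end ExponentTwo

end CyclicCMType

end Literature.NumberTheory.ComplexMultiplication
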